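import Summits.Ventures.HodgeRepro2.A2HermitianFromAlternating
import Summits.Ventures.HodgeRepro2.A2Positivity

/-!
# Prop. A4.2.4 Step 2 — every hermitian form is a difference of two positive definite ones

Blind cell pub-hodge-repro2, seat p6 (sub-claim A2 annex, Tier 4). Imports my rows 73 (`A2HermitianFromAlternating`:
`IsHermitian` in Lange's convention) and 3 (`A2Positivity`: `exists_nat_add_norm_sq_pos`).

PRINTED INPUTS (held `book:lange1992-complex-abelian-varieties`, A2 external-facts rows): E24 (p0036 ll. 17, 26; p0037
ll. 8–12: c₁ a homomorphism; NS(X) = hermitian forms with Im H(Λ, Λ) ⊂ ℤ; c₁(L(H, χ)) = H), E25 (p0054 l. 1: a line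
bundle is positive iff its hermitian form is positive definite), E27 (p0082 ll. 3–8: Prop. 2.1.11 ample ⟺ positive).
Step 2 of Prop. A4.2.4 (route/T4-A2-p6.md) writes the hermitian form H of a class of NS(X) as H = H₁ − H₂ with
H₁ := H + nH₀ and H₂ := nH₀ both positive definite, H₀ the hermitian form of a polarisation and n ≫ 0.

WHAT IS PROVED HERE (the linear algebra of that sentence, on a finite-dimensional complex inner product space V):
* `IsPosDef H` — Lange's «positive definite» (E25): `0 < Re H(v, v)` for `v ≠ 0` (`H(v, v)` is real, row 73).
* `IsHermitian.reForm` — the real part of a hermitian form as a real bilinear form; `IsHermitian.continuous_re_self` —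
  `v ↦ Re H(v, v)` is continuous (finite dimension); `IsHermitian.re_self_real_smul` — it is 2-homogeneous.
* `exists_pos_mul_norm_sq_le` — a positive definite hermitian form dominates a multiple of the norm:
  `∃ c > 0, c‖v‖² ≤ Re H₀(v, v)` (minimum on the unit sphere).
* **`exists_nat_isPosDef_add_nsmul`** — for `H` hermitian and `H₀` positive definite hermitian there is `n : ℕ` with
  `H + nH₀` positive definite (row 3's `exists_nat_add_norm_sq_pos` for `Re H`, then the domination above).
* **`exists_posDef_sub_posDef`** — Step 2's display: `H = (H + nH₀) − nH₀` with `n ≥ 1`, both summands positive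
  definite hermitian forms.
* `stdHerm` = `⟪w, v⟫` (Lange's convention) is a positive definite hermitian form — the non-vacuity witness for `H₀`.
What stays prose: that H₀ is the form of a polarisation (E28: X is an abelian variety) and that integral multiples
of integral forms stay integral on Λ (E24) — the lattice is not modelled.
§8(d) declaration: uses an L-value-free non-vanishing device: NO.
-/

noncomputable section

namespace Summit.Ventures.HodgeRepro2

open Complex

namespace A2HermitianFromAlternating.IsHermitian

variable {V : Type*} [AddCommGroup V] [Module ℂ V] {H H₀ : V → V → ℂ}

/-- Sums of hermitian forms are hermitian. -/
lemma add (hH : IsHermitian H) (hH₀ : IsHermitian H₀) : IsHermitian (fun v w => H v w + H₀ v w) where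
  add_left v v' w := by simp only [hH.add_left, hH₀.add_left]; ring
  smul_left c v w := by simp only [hH.smul_left, hH₀.smul_left]; ring
  conj_symm v w := by simp only [hH.conj_symm v w, hH₀.conj_symm v w, map_add]

/-- Natural multiples of hermitian forms are hermitian. -/
lemma natMul (hH : IsHermitian H) (n : ℕ) : IsHermitian (fun v w => (n : ℂ) * H v w) where
  add_left v v' w := by simp only [hH.add_left]; ring
  smul_left c v w := by simp only [hH.smul_left]; ring
  conj_symm v w := by simp only [hH.conj_symm v w, map_mul, map_natCast]

/-- `H(0, w) = 0`. -/
lemma zero_left (hH : IsHermitian H) (w : V) : H 0 w = 0 := by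
  have h := hH.add_left 0 0 w
  rw [add_zero] at h
  exact (add_eq_left.mp h.symm)

/-- Real scalars: `H(rv, w) = r H(v, w)` for `r : ℝ` (through `Module ℝ V`). -/
lemma real_smul_left (hH : IsHermitian H) (r : ℝ) (v w : V) : H (r • v) w = (r : ℂ) * H v w := by
  rw [← Complex.coe_smul, hH.smul_left]

/-- Real scalars on the right: `H(v, rw) = r H(v, w)` for `r : ℝ`. -/
lemma real_smul_right (hH : IsHermitian H) (r : ℝ) (v w : V) : H v (r • w) = (r : ℂ) * H v w := by
  rw [← Complex.coe_smul, hH.smul_right, Complex.conj_ofReal]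

/-- `Re H(rv, rv) = r² Re H(v, v)` for real `r`: 2-homogeneity of the quadratic form. -/
lemma re_self_real_smul (hH : IsHermitian H) (r : ℝ) (v : V) :
    (H (r • v) (r • v)).re = r ^ 2 * (H v v).re := by
  rw [hH.real_smul_left, hH.real_smul_right, ← mul_assoc, ← Complex.ofReal_mul, Complex.re_ofReal_mul, pow_two]

/-- The real part of a hermitian form, as a real bilinear form on `V`. -/
def reForm (hH : IsHermitian H) : V →ₗ[ℝ] V →ₗ[ℝ] ℝ :=
  LinearMap.mk₂ ℝ (fun v w => (H v w).re)
    (fun v v' w => by simp [hH.add_left])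
    (fun r v w => by simp [hH.real_smul_left])
    (fun v w w' => by simp [hH.add_right])
    (fun r v w => by simp [hH.real_smul_right])

/-- `reForm` evaluates to `Re H(v, w)`. -/
@[simp] lemma reForm_apply (hH : IsHermitian H) (v w : V) : reForm hH v w = (H v w).re := rfl

/-- `v ↦ Re H(v, v)` is continuous on a finite-dimensional space (a real bilinear form in finite dimension is
continuous: `v ↦ (w ↦ Re H(v, w))` is a linear map into the continuous linear functionals). -/
lemma continuous_re_self {V : Type*} [NormedAddCommGroup V] [NormedSpace ℂ V] [FiniteDimensional ℂ V]
    {H : V → V → ℂ} (hH : IsHermitian H) :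
    Continuous fun v : V => (H v v).re := by
  let B : V →ₗ[ℝ] (V →L[ℝ] ℝ) :=
    (LinearMap.toContinuousLinearMap : (V →ₗ[ℝ] ℝ) ≃ₗ[ℝ] (V →L[ℝ] ℝ)).toLinearMap ∘ₗ hH.reForm
  have hB : Continuous B := LinearMap.continuous_of_finiteDimensional B
  have : (fun v : V => (H v v).re) = fun v => (B v) v := by
    funext v
    simp [B]
  rw [this]
  exact isBoundedBilinearMap_apply.continuous.comp (hB.prodMk continuous_id)

end A2HermitianFromAlternating.IsHermitian

namespace A2PositiveDifference

open A2HermitianFromAlternating A2Positivity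

variable {V : Type*} [NormedAddCommGroup V] [InnerProductSpace ℂ V]

/-- Lange's «positive definite» (E25, p0054 l. 1) for a hermitian form in the convention of row 73:
`Re H(v, v) > 0` for every `v ≠ 0` (`H(v, v)` is real by `IsHermitian.im_self`). -/
def IsPosDef (H : V → V → ℂ) : Prop := ∀ v : V, v ≠ 0 → 0 < (H v v).re

/-- The standard hermitian form in Lange's convention (ℂ-linear in the first variable): `H₀(v, w) = ⟪w, v⟫`. -/
def stdHerm (v w : V) : ℂ := inner ℂ w v

/-- `stdHerm` is hermitian. -/
lemma isHermitian_stdHerm : IsHermitian (stdHerm : V → V → ℂ) where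
  add_left v v' w := by simp [stdHerm]
  smul_left c v w := by simp [stdHerm]
  conj_symm v w := by simp [stdHerm]

/-- `stdHerm` is positive definite: `Re ⟪v, v⟫ = ‖v‖² > 0`. -/
lemma isPosDef_stdHerm : IsPosDef (stdHerm : V → V → ℂ) := by
  intro v hv
  have h := inner_self_eq_norm_sq (𝕜 := ℂ) v
  rw [RCLike.re_to_complex] at h
  simp only [stdHerm]
  rw [h]
  positivity

/-- `((n : ℂ) * z).re = n * z.re`. -/
lemma re_natCast_mul (n : ℕ) (z : ℂ) : ((n : ℂ) * z).re = n * z.re := by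
  simp [Complex.mul_re]

/-- A positive definite hermitian form dominates a positive multiple of `‖·‖²` (the minimum of `Re H₀` on the unit
sphere, which is compact in finite dimension). -/
theorem exists_pos_mul_norm_sq_le [FiniteDimensional ℂ V] {H₀ : V → V → ℂ} (hH₀ : IsHermitian H₀)
    (hpos : IsPosDef H₀) : ∃ c : ℝ, 0 < c ∧ ∀ v : V, c * ‖v‖ ^ 2 ≤ (H₀ v v).re := by
  -- the real inner-product structure underlying the complex one (the norm is the same)
  letI : InnerProductSpace ℝ V := InnerProductSpace.complexToReal
  by_cases hV : Nontrivial V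
  · -- the unit sphere is compact and non-empty
    obtain ⟨u, hu⟩ := exists_ne (0 : V)
    have hne : (Metric.sphere (0 : V) 1).Nonempty := ⟨_, inv_norm_smul_mem_sphere u hu⟩
    obtain ⟨v₀, hv₀, hmin⟩ := (isCompact_sphere (0 : V) 1).exists_isMinOn hne
      (f := fun v : V => (H₀ v v).re) hH₀.continuous_re_self.continuousOn
    have hv₀ne : v₀ ≠ 0 := by
      intro h
      rw [h] at hv₀
      simp at hv₀
    refine ⟨(H₀ v₀ v₀).re, hpos v₀ hv₀ne, ?_⟩
    intro v
    by_cases hv : v = 0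
    · simp [hv, hH₀.zero_left]
    · have hmem := inv_norm_smul_mem_sphere v hv
      have hle : (H₀ v₀ v₀).re ≤ (H₀ (‖v‖⁻¹ • v) (‖v‖⁻¹ • v)).re := hmin hmem
      rw [hH₀.re_self_real_smul] at hle
      have hnorm : 0 < ‖v‖ := norm_pos_iff.mpr hv
      have hinv : (‖v‖⁻¹) ^ 2 * (H₀ v v).re = (H₀ v v).re / ‖v‖ ^ 2 := by
        field_simp
      rw [hinv, le_div_iff₀ (by positivity)] at hle
      linarith
  · -- a trivial space: every vector is 0
    refine ⟨1, one_pos, fun v => ?_⟩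
    have : v = 0 := by
      rw [not_nontrivial_iff_subsingleton] at hV
      exact Subsingleton.elim v 0
    simp [this, hH₀.zero_left]

/-- **Step 2 of Prop. A4.2.4, the existence of `n`**: for `H` hermitian and `H₀` positive definite hermitian on a
finite-dimensional complex inner product space, `H + nH₀` is positive definite for some `n : ℕ`
(row 3's `exists_nat_add_norm_sq_pos` applied to `Re H`, then `c‖v‖² ≤ Re H₀(v, v)`). -/
theorem exists_nat_isPosDef_add_nsmul [FiniteDimensional ℂ V] {H H₀ : V → V → ℂ} (hH : IsHermitian H)
    (hH₀ : IsHermitian H₀) (hpos : IsPosDef H₀) :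
    ∃ n : ℕ, IsPosDef (fun v w => H v w + (n : ℂ) * H₀ v w) := by
  letI : InnerProductSpace ℝ V := InnerProductSpace.complexToReal
  obtain ⟨m, hm⟩ := exists_nat_add_norm_sq_pos (fun v : V => (H v v).re) hH.continuous_re_self
    (fun r v => hH.re_self_real_smul r v)
  obtain ⟨c, hc, hdom⟩ := exists_pos_mul_norm_sq_le hH₀ hpos
  obtain ⟨n, hn⟩ := exists_nat_ge ((m : ℝ) / c)
  refine ⟨n, fun v hv => ?_⟩
  have h1 := hm v hv
  have h2 := hdom v
  have h0 : 0 ≤ (H₀ v v).re := le_of_lt (hpos v hv)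
  have hmc : (m : ℝ) * ‖v‖ ^ 2 ≤ (n : ℝ) * (H₀ v v).re := by
    have hm' : (m : ℝ) ≤ n * c := by
      rwa [div_le_iff₀ hc] at hn
    calc (m : ℝ) * ‖v‖ ^ 2 ≤ (n * c) * ‖v‖ ^ 2 := by gcongr
      _ = (n : ℝ) * (c * ‖v‖ ^ 2) := by ring
      _ ≤ (n : ℝ) * (H₀ v v).re := by gcongr
  simp only [Complex.add_re, re_natCast_mul]
  linarith

/-- **Step 2 of Prop. A4.2.4, the display `H = H₁ − H₂`**: there is `n ≥ 1` such that `H₁ := H + nH₀` and `H₂ := nH₀`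
are positive definite hermitian forms and `H = H₁ − H₂` (the trivial identity, recorded). -/
theorem exists_posDef_sub_posDef [FiniteDimensional ℂ V] {H H₀ : V → V → ℂ} (hH : IsHermitian H)
    (hH₀ : IsHermitian H₀) (hpos : IsPosDef H₀) :
    ∃ n : ℕ, 0 < n ∧ IsHermitian (fun v w => H v w + (n : ℂ) * H₀ v w) ∧
      IsPosDef (fun v w => H v w + (n : ℂ) * H₀ v w) ∧ IsHermitian (fun v w => (n : ℂ) * H₀ v w) ∧
      IsPosDef (fun v w => (n : ℂ) * H₀ v w) ∧
      ∀ v w, H v w = (H v w + (n : ℂ) * H₀ v w) - (n : ℂ) * H₀ v w := by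
  obtain ⟨n, hn⟩ := exists_nat_isPosDef_add_nsmul hH hH₀ hpos
  refine ⟨n + 1, Nat.succ_pos n, hH.add (hH₀.natMul (n + 1)), ?_, hH₀.natMul (n + 1), ?_, fun v w => by ring⟩
  · intro v hv
    have h1 := hn v hv
    have h0 := hpos v hv
    simp only [Complex.add_re, re_natCast_mul] at h1 ⊢
    push_cast
    nlinarith
  · intro v hv
    have h0 := hpos v hv
    simp only [re_natCast_mul]
    positivity

end A2PositiveDifference

end Summit.Ventures.HodgeRepro2

end
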